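import Summits.CriticalPhenomena.PercolationContinuityZ3.Theorems.FK.InfiniteVolumeDLR
import Summits.CriticalPhenomena.PercolationContinuityZ3.Theorems.FK.DomainMarkovToolkit
import Literature.Probability.LatticeModels.RandomClusterDomainMarkovFree
import HarnessLib

/-!
# FK-continuity transplant, FO-10 (domain-Markov toolkit, seat A): monotonicity of the free / wired region laws
# in the REGION — Grimmett's (4.24) for general nested regions `Λ ⊆ Δ ⊆ ℤ^d`

Cell `fk-continuity` (bschramm), row FO-10a (gen-2 successor item (iii) of the gen-1 hand-off); support file
for the FK-continuity transplant (`--supports stmt-CriticalPhenomena-4575`); builds on p205010 (kernel theorem,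
internal audit signed; external expert review pending).  Pure proofs; no definitions, no named facts, no sorries.

Grimmett 2006, proof of Thm. (4.19)(a), eq. (4.24) p. 78: for `Λ ⊆ Δ` and increasing `B ∈ 𝓕_Λ`,
`φ⁰_{Λ,p,q}(B) = φ⁰_{Δ,p,q}(B | E_Δ ∖ E_Λ closed) ≤ φ⁰_{Δ,p,q}(B)`, "and we reverse the inequality" for the wired
measures.  The tree has this for BOXES (`rcBoxLaw_false_real_mono`, `rcBoxLaw_true_real_anti_of_determinedBy`,
`InfiniteVolumeMonotone.lean`; the Literature's finite-graph wired form `rcMeasure_real_restrict_le` asks the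
environment `Δ ∖ Λ ∪ ∂Λ` to be connected through `E_Δ ∖ E_Λ` and the wiring of `∂Δ`, which fails for regions with
holes).  Here, for the cell's region laws `regionFreeReal` / `regionWiredReal` (`InfiniteVolumeGibbs.lean`;
`regionWiredReal` wires the WHOLE inner vertex boundary `∂Λ`, holes included, into one class) and ARBITRARY finite
`Λ ⊆ Δ ⊆ ℤ^d`, `p ∈ [0,1]`, `q ≥ 1`:

* **the sandwich in an arbitrary ambient region** — for any wired set `B` of `Δ`, an increasing event `A`
  determined by `E_Λ` and an event `H` determined by finitely many pairs off `E_Λ`: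
  `regionFreeReal_mul_rcMeasure_region_le` (`φ⁰_Λ(A) · φ^B_Δ(H) ≤ φ^B_Δ(A ∩ H)`) and, when `B` lies in the
  environment set `envSet Λ Δ` (e.g. `B = ∅`, `B = ∂Δ`), `rcMeasure_region_le_regionWiredReal_mul`
  (`φ^B_Δ(A ∩ H) ≤ φ¹_Λ(A) · φ^B_Δ(H)`) — FO-06a's `regionFreeReal_mul_rcBoxMeasure_le` /
  `rcBoxMeasure_le_regionWiredReal_mul` (`InfiniteVolumeDLR.lean`) with the box `Λ_n` and its boundary condition
  replaced by `Δ` and `B` (same proof: the summed Holley dominations of `InfiniteVolumeDLRFinite.lean` plus the two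
  transports);
* **(4.24) for general nested regions** — `regionFreeReal_mono` (`φ⁰_Λ(A) ≤ φ⁰_Δ(A)` for EVERY increasing `A`,
  via the Literature's free domain Markov property `rcMeasure_real_free_le_restrict`, no locality needed),
  `regionWiredReal_anti` (`φ¹_Δ(A) ≤ φ¹_Λ(A)` for increasing `A` determined by `E_Λ`; NO connectivity
  hypothesis), the mixed `regionFreeReal_le_rcMeasure_region` / `rcMeasure_region_le_regionWiredReal`
  (`φ⁰_Λ ≤ φ^B_Δ ≤ φ¹_Λ` on `𝓕_Λ`-increasing events), and the decreasing duals
  `regionFreeReal_anti_of_isLowerSet` / `regionWiredReal_mono_of_isLowerSet`.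

## References

* G. Grimmett, *The Random-Cluster Model*, Springer 2006: §4.2 (4.11)–(4.13), Lemma (4.13), Lemma (4.14)(b);
  Thm. (4.19)(a), proof, eq. (4.24) p. 78. [Grimmett2006]
-/

noncomputable section

open MeasureTheory Set Filter
open scoped Topology ENNReal

namespace Summit.CriticalPhenomena.PercolationContinuityZ3.Theorems.FK

open Literature.Probability.Percolation Literature.Probability.LatticeModels

variable {d : ℕ}

/-! ### 1. The sandwich in an arbitrary ambient region `Δ ⊇ Λ` with arbitrary wiring `B` -/

section Ambient

open Finset SimpleGraph

/-- **Lower sandwich in an ambient region**: for finite `Λ ⊆ Δ ⊆ ℤ^d`, any wired set `B` of `Δ`, an increasing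
event `A` determined by `E_Λ` and an event `H` determined by a finite pair set disjoint from `E_Λ`,
`φ⁰_{Λ,p,q}(A) · φ^B_{Δ,p,q}(H) ≤ φ^B_{Δ,p,q}(A ∩ H)` (events read on `ℤ^d` through `liftEdges Δ`; `q ≥ 1`).
[cite: Grimmett2006, Lemma (4.13) and Lemma (4.14)(b)] -/
theorem regionFreeReal_mul_rcMeasure_region_le {p q : ℝ} (hp : p ∈ Set.Icc (0 : ℝ) 1) (hq : 1 ≤ q)
    {Λ Δ : Finset (Site d)} (hΛ : Λ ⊆ Δ) (B : Set ↥Δ) {A H : Set (BondConfig (Site d))}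
    (T : Finset (Sym2 (Site d))) (hA : IsUpperSet A) (hAΛ : DeterminedBy A ↑(edgesIn (zdGraph d) Λ))
    (hT : Disjoint (↑T : Set (Sym2 (Site d))) ↑(edgesIn (zdGraph d) Λ)) (hH : DeterminedBy H ↑T) :
    regionFreeReal d p q Λ A * (rcMeasure (finsetGraph (zdGraph d) Δ) p q B).real (liftEdges Δ ⁻¹' H) ≤
      (rcMeasure (finsetGraph (zdGraph d) Δ) p q B).real (liftEdges Δ ⁻¹' (A ∩ H)) := by
  have hq0 : 0 < q := one_pos.trans_le hq
  set U := insideEdges (zdGraph d) hΛ with hU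
  have hAU : ∀ ω, ω ∈ liftEdges Δ ⁻¹' A ↔ ω ∩ ↑U ∈ liftEdges Δ ⁻¹' A :=
    mem_preimage_liftEdges_iff_inter (fun e he =>
      Finset.mem_coe.2 ((mem_insideEdges_iff_map_val_mem_edgesIn hΛ e).2 he)) hAΛ
  have hS : ∀ ω, ω ∈ liftEdges Δ ⁻¹' H ↔ ω ∩ (↑U : Set (Sym2 ↥Δ))ᶜ ∈ liftEdges Δ ⁻¹' H :=
    mem_preimage_liftEdges_iff_inter (fun e he heU =>
      Set.disjoint_left.1 hT he ((mem_insideEdges_iff_map_val_mem_edgesIn hΛ e).1 heU)) hH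
  have hAup : IsUpperSet (liftEdges Δ ⁻¹' A) := hA.preimage (fun _ _ h => Set.image_mono h : Monotone (liftEdges Δ))
  have key := rcMeasure_fromEdgeSet_real_mul_le_real_inter (finsetGraph (zdGraph d) Δ) hp hq
    B U (insideEdges_subset_edgeFinset hΛ) hAup hAU hS
  have hfree : regionFreeReal d p q Λ A ≤
      (rcMeasure (fromEdgeSet (↑U : Set (Sym2 ↥Δ))) p q B).real (liftEdges Δ ⁻¹' A) := by
    rw [regionFreeReal, ← rcMeasure_fromEdgeSet_insideEdges_empty_real hp hq0 hΛ A]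
    exact rcMeasure_real_mono_wired_of_isUpperSet _ hp hq (Set.empty_subset _) hAup
  rw [Set.preimage_inter]
  exact (mul_le_mul_of_nonneg_right hfree measureReal_nonneg).trans key

/-- **Upper sandwich in an ambient region**: with `Λ ⊆ Δ`, `A`, `H` as above and a wired set `B` of `Δ` inside
the environment set of `Λ` (everything off `Λ` plus `∂Λ` — e.g. `B = ∅` or `B = ∂Δ`),
`φ^B_{Δ,p,q}(A ∩ H) ≤ φ¹_{Λ,p,q}(A) · φ^B_{Δ,p,q}(H)`; `φ¹_Λ` wires the whole inner vertex boundary `∂Λ`, so no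
connectivity of the environment is needed. [cite: Grimmett2006, Lemma (4.13) and Lemma (4.14)(b)] -/
theorem rcMeasure_region_le_regionWiredReal_mul {p q : ℝ} (hp : p ∈ Set.Icc (0 : ℝ) 1) (hq : 1 ≤ q)
    {Λ Δ : Finset (Site d)} (hΛ : Λ ⊆ Δ) {B : Set ↥Δ} (hB : B ⊆ envSet (zdGraph d) Λ Δ)
    {A H : Set (BondConfig (Site d))} (T : Finset (Sym2 (Site d))) (hA : IsUpperSet A)
    (hAΛ : DeterminedBy A ↑(edgesIn (zdGraph d) Λ))
    (hT : Disjoint (↑T : Set (Sym2 (Site d))) ↑(edgesIn (zdGraph d) Λ)) (hH : DeterminedBy H ↑T) :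
    (rcMeasure (finsetGraph (zdGraph d) Δ) p q B).real (liftEdges Δ ⁻¹' (A ∩ H)) ≤
      regionWiredReal d p q Λ A * (rcMeasure (finsetGraph (zdGraph d) Δ) p q B).real (liftEdges Δ ⁻¹' H) := by
  have hq0 : 0 < q := one_pos.trans_le hq
  haveI : IsProbabilityMeasure (rcMeasure (finsetGraph (zdGraph d) Δ) p q B) :=
    isProbabilityMeasure_rcMeasure _ hp hq0 _
  -- degenerate case: `E_Λ = ∅`, then `A` is trivial
  by_cases hE : (edgesIn (zdGraph d) Λ).Nonempty
  swap
  · rw [Finset.not_nonempty_iff_eq_empty] at hE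
    rw [hE, Finset.coe_empty] at hAΛ
    have htriv : ∀ ω ω' : BondConfig (Site d), (ω ∈ A ↔ ω' ∈ A) := fun ω ω' =>
      (determinedBy_iff _ _).1 hAΛ ω ω' (by simp)
    by_cases h0 : (∅ : BondConfig (Site d)) ∈ A
    · have hAu : A = Set.univ := Set.eq_univ_of_forall fun ω => (htriv ω ∅).2 h0
      subst hAu
      have h1 : regionWiredReal d p q Λ Set.univ = 1 := by
        haveI := isProbabilityMeasure_rcMeasure (finsetGraph (zdGraph d) Λ) hp hq0 (wiredBoundary (zdGraph d) Λ)
        rw [regionWiredReal, Set.preimage_univ, probReal_univ]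
      rw [h1, one_mul, Set.univ_inter]
    · have hAe : A = ∅ := Set.eq_empty_of_forall_notMem fun ω hω => h0 ((htriv ω ∅).1 hω)
      subst hAe
      rw [Set.empty_inter, Set.preimage_empty, measureReal_empty]
      exact mul_nonneg measureReal_nonneg measureReal_nonneg
  set U := insideEdges (zdGraph d) hΛ with hU
  have hAU : ∀ ω, ω ∈ liftEdges Δ ⁻¹' A ↔ ω ∩ ↑U ∈ liftEdges Δ ⁻¹' A :=
    mem_preimage_liftEdges_iff_inter (fun e he =>
      Finset.mem_coe.2 ((mem_insideEdges_iff_map_val_mem_edgesIn hΛ e).2 he)) hAΛ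
  have hS : ∀ ω, ω ∈ liftEdges Δ ⁻¹' H ↔ ω ∩ (↑U : Set (Sym2 ↥Δ))ᶜ ∈ liftEdges Δ ⁻¹' H :=
    mem_preimage_liftEdges_iff_inter (fun e he heU =>
      Set.disjoint_left.1 hT he ((mem_insideEdges_iff_map_val_mem_edgesIn hΛ e).1 heU)) hH
  have hAup : IsUpperSet (liftEdges Δ ⁻¹' A) := hA.preimage (fun _ _ h => Set.image_mono h : Monotone (liftEdges Δ))
  have key := rcMeasure_real_inter_le_fromEdgeSet_real_mul (finsetGraph (zdGraph d) Δ) hp hq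
    B U (insideEdges_subset_edgeFinset hΛ) hB
    (fun e he heU => mem_envSet_of_mem_edgeSet_of_notMem_insideEdges hΛ he heU) hAup hAU hS
  rw [rcMeasure_fromEdgeSet_insideEdges_envSet_real hp hq0 hΛ (wiredBoundary_nonempty_of_edgesIn_nonempty hE) A]
    at key
  rw [Set.preimage_inter, regionWiredReal]
  exact key

/-- Unconditioned lower bound (`H = univ`): `φ⁰_{Λ,p,q}(A) ≤ φ^B_{Δ,p,q}(A)` for `Λ ⊆ Δ`, ANY wired set `B` of
`Δ`, and `A` increasing determined by `E_Λ`. [cite: Grimmett2006, Lemma (4.14)(b) and Thm. (4.19)(a), proof, eq. (4.24)] -/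
theorem regionFreeReal_le_rcMeasure_region {p q : ℝ} (hp : p ∈ Set.Icc (0 : ℝ) 1) (hq : 1 ≤ q)
    {Λ Δ : Finset (Site d)} (hΛ : Λ ⊆ Δ) (B : Set ↥Δ) {A : Set (BondConfig (Site d))} (hA : IsUpperSet A)
    (hAΛ : DeterminedBy A ↑(edgesIn (zdGraph d) Λ)) :
    regionFreeReal d p q Λ A ≤ (rcMeasure (finsetGraph (zdGraph d) Δ) p q B).real (liftEdges Δ ⁻¹' A) := by
  haveI : IsProbabilityMeasure (rcMeasure (finsetGraph (zdGraph d) Δ) p q B) :=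
    isProbabilityMeasure_rcMeasure _ hp (one_pos.trans_le hq) _
  have h := regionFreeReal_mul_rcMeasure_region_le hp hq hΛ B (H := Set.univ) ∅ hA hAΛ (by simp)
    ((determinedBy_iff _ _).2 fun _ _ _ => Iff.rfl)
  simpa using h

/-- Unconditioned upper bound (`H = univ`): `φ^B_{Δ,p,q}(A) ≤ φ¹_{Λ,p,q}(A)` for `Λ ⊆ Δ`, a wired set `B` of `Δ`
inside the environment set of `Λ`, and `A` increasing determined by `E_Λ`.
[cite: Grimmett2006, Lemma (4.14)(b) and Thm. (4.19)(a), proof, eq. (4.24)] -/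
theorem rcMeasure_region_le_regionWiredReal {p q : ℝ} (hp : p ∈ Set.Icc (0 : ℝ) 1) (hq : 1 ≤ q)
    {Λ Δ : Finset (Site d)} (hΛ : Λ ⊆ Δ) {B : Set ↥Δ} (hB : B ⊆ envSet (zdGraph d) Λ Δ)
    {A : Set (BondConfig (Site d))} (hA : IsUpperSet A) (hAΛ : DeterminedBy A ↑(edgesIn (zdGraph d) Λ)) :
    (rcMeasure (finsetGraph (zdGraph d) Δ) p q B).real (liftEdges Δ ⁻¹' A) ≤ regionWiredReal d p q Λ A := by
  haveI : IsProbabilityMeasure (rcMeasure (finsetGraph (zdGraph d) Δ) p q B) :=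
    isProbabilityMeasure_rcMeasure _ hp (one_pos.trans_le hq) _
  have h := rcMeasure_region_le_regionWiredReal_mul hp hq hΛ hB (H := Set.univ) ∅ hA hAΛ (by simp)
    ((determinedBy_iff _ _).2 fun _ _ _ => Iff.rfl)
  simpa using h

end Ambient

/-! ### 2. (4.24) for general nested regions: `φ⁰_Λ` increases and `φ¹_Λ` decreases in `Λ` -/

section Nested

open Finset SimpleGraph

/-- Restricting a configuration of `Δ` to `Λ ⊆ Δ` and reading it on `ℤ^d` keeps exactly the open pairs with both
endpoints in `Λ` (the box case is `liftEdges_finsetRestrict`, `InfiniteVolumeMonotone.lean`).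
[cite: Grimmett2006, §4.2 (configurations on E_Λ)] -/
theorem liftEdges_finsetRestrict_of_subset {Λ Δ : Finset (Site d)} (h : Λ ⊆ Δ) (ω : BondConfig ↥Δ) :
    liftEdges Λ (finsetRestrict h ω) = liftEdges Δ ω ∩ {e | ∀ z ∈ e, z ∈ Λ} := by
  ext e
  simp only [mem_liftEdges_iff, mem_finsetRestrict_iff, Set.mem_inter_iff, Set.mem_setOf_eq]
  constructor
  · rintro ⟨e', he', rfl⟩
    induction e' using Sym2.ind with
    | h u v =>
      refine ⟨⟨edgeLift h s(u, v), he', ?_⟩, ?_⟩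
      · rw [edgeLift_mk, Sym2.map_mk, Sym2.map_mk]
        rfl
      · intro z hz
        rw [Sym2.map_mk, Sym2.mem_iff] at hz
        rcases hz with rfl | rfl
        · exact u.2
        · exact v.2
  · rintro ⟨⟨e'', he'', rfl⟩, hin⟩
    induction e'' using Sym2.ind with
    | h u v =>
      have hu : u.1 ∈ Λ := hin u.1 (by rw [Sym2.map_mk]; exact Sym2.mem_mk_left _ _)
      have hv : v.1 ∈ Λ := hin v.1 (by rw [Sym2.map_mk]; exact Sym2.mem_mk_right _ _)
      refine ⟨s(⟨u.1, hu⟩, ⟨v.1, hv⟩), ?_, by rw [Sym2.map_mk, Sym2.map_mk]⟩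
      have : edgeLift h s(⟨u.1, hu⟩, ⟨v.1, hv⟩) = s(u, v) := by
        rw [edgeLift_mk]
        rfl
      show edgeLift h s(⟨u.1, hu⟩, ⟨v.1, hv⟩) ∈ ω
      rw [this]
      exact he''

/-- **The free region laws increase with the region, on every increasing event** (Grimmett's (4.24) for
arbitrary finite `Λ ⊆ Δ ⊆ ℤ^d`; no locality: the restriction to `Λ` lifts to a sub-configuration):
`φ⁰_{Λ,p,q}(A) ≤ φ⁰_{Δ,p,q}(A)`, `p ∈ [0,1]`, `q ≥ 1`. [cite: Grimmett2006, Thm. (4.19)(a), proof, eq. (4.24)] -/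
theorem regionFreeReal_mono {p q : ℝ} (hp : p ∈ Set.Icc (0 : ℝ) 1) (hq : 1 ≤ q) {Λ Δ : Finset (Site d)}
    (hΛ : Λ ⊆ Δ) {A : Set (BondConfig (Site d))} (hA : IsUpperSet A) :
    regionFreeReal d p q Λ A ≤ regionFreeReal d p q Δ A := by
  haveI := isProbabilityMeasure_rcMeasure (finsetGraph (zdGraph d) Δ) hp (one_pos.trans_le hq) (∅ : Set ↥Δ)
  rw [regionFreeReal, regionFreeReal]
  calc (rcMeasure (finsetGraph (zdGraph d) Λ) p q ∅).real (liftEdges Λ ⁻¹' A)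
      ≤ (rcMeasure (finsetGraph (zdGraph d) Δ) p q ∅).real
          (finsetRestrict hΛ ⁻¹' (liftEdges Λ ⁻¹' A)) :=
        rcMeasure_real_free_le_restrict hΛ hp hq (hA.preimage (fun _ _ h => Set.image_mono h : Monotone (liftEdges Λ)))
    _ ≤ (rcMeasure (finsetGraph (zdGraph d) Δ) p q ∅).real (liftEdges Δ ⁻¹' A) := by
        refine measureReal_mono (fun ω hω => hA ?_ hω) (measure_ne_top _ _)
        rw [liftEdges_finsetRestrict_of_subset hΛ]
        exact Set.inter_subset_left

/-- **The wired region laws decrease with the region, on increasing events determined inside the smaller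
region** ((4.24) reversed; arbitrary finite `Λ ⊆ Δ ⊆ ℤ^d`, regions with holes allowed, no connectivity
hypothesis): `φ¹_{Δ,p,q}(A) ≤ φ¹_{Λ,p,q}(A)`. [cite: Grimmett2006, Thm. (4.19)(a), proof, eq. (4.24)] -/
theorem regionWiredReal_anti {p q : ℝ} (hp : p ∈ Set.Icc (0 : ℝ) 1) (hq : 1 ≤ q) {Λ Δ : Finset (Site d)}
    (hΛ : Λ ⊆ Δ) {A : Set (BondConfig (Site d))} (hA : IsUpperSet A)
    (hAΛ : DeterminedBy A ↑(edgesIn (zdGraph d) Λ)) :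
    regionWiredReal d p q Δ A ≤ regionWiredReal d p q Λ A :=
  rcMeasure_region_le_regionWiredReal hp hq hΛ
    (Summit.CriticalPhenomena.PercolationContinuityZ3.Theorems.FK.wiredBoundary_subset_envSet hΛ) hA hAΛ

/-- Mixed boundary conditions, lower side: `φ⁰_{Λ,p,q}(A) ≤ φ¹_{Δ,p,q}(A)` for `Λ ⊆ Δ` and `A` increasing
determined by `E_Λ`. [cite: Grimmett2006, Lemma (4.14)(b) and Thm. (4.19)(a), proof, eq. (4.24)] -/
theorem regionFreeReal_le_regionWiredReal_of_subset {p q : ℝ} (hp : p ∈ Set.Icc (0 : ℝ) 1) (hq : 1 ≤ q)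
    {Λ Δ : Finset (Site d)} (hΛ : Λ ⊆ Δ) {A : Set (BondConfig (Site d))} (hA : IsUpperSet A)
    (hAΛ : DeterminedBy A ↑(edgesIn (zdGraph d) Λ)) :
    regionFreeReal d p q Λ A ≤ regionWiredReal d p q Δ A :=
  regionFreeReal_le_rcMeasure_region hp hq hΛ _ hA hAΛ

/-- Mixed boundary conditions, upper side: `φ⁰_{Δ,p,q}(A) ≤ φ¹_{Λ,p,q}(A)` for `Λ ⊆ Δ` and `A` increasing
determined by `E_Λ` (the free measure of the LARGER region is still below the wired measure of the smaller one).
[cite: Grimmett2006, Lemma (4.14)(b) and Thm. (4.19)(a), proof, eq. (4.24)] -/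
theorem regionFreeReal_le_regionWiredReal_of_superset {p q : ℝ} (hp : p ∈ Set.Icc (0 : ℝ) 1) (hq : 1 ≤ q)
    {Λ Δ : Finset (Site d)} (hΛ : Λ ⊆ Δ) {A : Set (BondConfig (Site d))} (hA : IsUpperSet A)
    (hAΛ : DeterminedBy A ↑(edgesIn (zdGraph d) Λ)) :
    regionFreeReal d p q Δ A ≤ regionWiredReal d p q Λ A :=
  rcMeasure_region_le_regionWiredReal hp hq hΛ (by simp) hA hAΛ

/-- `φ⁰_{Λ,p,q}(Dᶜ) = 1 - φ⁰_{Λ,p,q}(D)` for measurable `D` (`p ∈ [0,1]`, `q > 0`). [cite: Grimmett2006, §4.2 (4.12)] -/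
theorem regionFreeReal_compl {p q : ℝ} (hp : p ∈ Set.Icc (0 : ℝ) 1) (hq : 0 < q) (Λ : Finset (Site d))
    {D : Set (BondConfig (Site d))} (hDm : MeasurableSet D) :
    regionFreeReal d p q Λ Dᶜ = 1 - regionFreeReal d p q Λ D := by
  haveI := isProbabilityMeasure_rcMeasure (finsetGraph (zdGraph d) Λ) hp hq (∅ : Set ↥Λ)
  rw [regionFreeReal, regionFreeReal, Set.preimage_compl,
    probReal_compl_eq_one_sub (measurableSet_preimage (measurable_of_finite _) hDm)]

/-- `φ¹_{Λ,p,q}(Dᶜ) = 1 - φ¹_{Λ,p,q}(D)` for measurable `D` (`p ∈ [0,1]`, `q > 0`). [cite: Grimmett2006, §4.2 (4.12)] -/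
theorem regionWiredReal_compl {p q : ℝ} (hp : p ∈ Set.Icc (0 : ℝ) 1) (hq : 0 < q) (Λ : Finset (Site d))
    {D : Set (BondConfig (Site d))} (hDm : MeasurableSet D) :
    regionWiredReal d p q Λ Dᶜ = 1 - regionWiredReal d p q Λ D := by
  haveI := isProbabilityMeasure_rcMeasure (finsetGraph (zdGraph d) Λ) hp hq (wiredBoundary (zdGraph d) Λ)
  rw [regionWiredReal, regionWiredReal, Set.preimage_compl,
    probReal_compl_eq_one_sub (measurableSet_preimage (measurable_of_finite _) hDm)]

/-- Decreasing dual: **the free region laws DECREASE with the region on decreasing events**,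
`φ⁰_{Δ,p,q}(D) ≤ φ⁰_{Λ,p,q}(D)` for `Λ ⊆ Δ` and measurable decreasing `D`. [cite: Grimmett2006, Thm. (4.19)(a), proof, eq. (4.24)] -/
theorem regionFreeReal_anti_of_isLowerSet {p q : ℝ} (hp : p ∈ Set.Icc (0 : ℝ) 1) (hq : 1 ≤ q)
    {Λ Δ : Finset (Site d)} (hΛ : Λ ⊆ Δ) {D : Set (BondConfig (Site d))} (hD : IsLowerSet D)
    (hDm : MeasurableSet D) : regionFreeReal d p q Δ D ≤ regionFreeReal d p q Λ D := by
  have hq0 : 0 < q := one_pos.trans_le hq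
  have h := regionFreeReal_mono hp hq hΛ hD.compl
  rw [regionFreeReal_compl hp hq0 Λ hDm, regionFreeReal_compl hp hq0 Δ hDm] at h
  linarith

/-- Decreasing dual: **the wired region laws INCREASE with the region on decreasing events determined inside the
smaller region**, `φ¹_{Λ,p,q}(D) ≤ φ¹_{Δ,p,q}(D)` for `Λ ⊆ Δ`. [cite: Grimmett2006, Thm. (4.19)(a), proof, eq. (4.24)] -/
theorem regionWiredReal_mono_of_isLowerSet {p q : ℝ} (hp : p ∈ Set.Icc (0 : ℝ) 1) (hq : 1 ≤ q)
    {Λ Δ : Finset (Site d)} (hΛ : Λ ⊆ Δ) {D : Set (BondConfig (Site d))} (hD : IsLowerSet D)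
    (hDΛ : DeterminedBy D ↑(edgesIn (zdGraph d) Λ)) :
    regionWiredReal d p q Λ D ≤ regionWiredReal d p q Δ D := by
  have hq0 : 0 < q := one_pos.trans_le hq
  have hDm : MeasurableSet D := measurableSet_of_isLocalEvent_holds ⟨_, hDΛ⟩
  have hDcΛ : DeterminedBy Dᶜ ↑(edgesIn (zdGraph d) Λ) := by
    rw [determinedBy_iff] at hDΛ ⊢
    exact fun ω ω' hω => not_congr (hDΛ ω ω' hω)
  have h := regionWiredReal_anti hp hq hΛ hD.compl hDcΛ
  rw [regionWiredReal_compl hp hq0 Λ hDm, regionWiredReal_compl hp hq0 Δ hDm] at h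
  linarith

end Nested

/-! ### 3. Reading for the sandwich class: larger regions give tighter finite-volume bounds -/

namespace FKGibbs

variable {p q : ℝ} {P : Measure (BondConfig (Site d))}

/-- For `P` of the sandwich class and nested regions `Λ ⊆ Δ`, an increasing event determined by `E_Λ` satisfies
the chain `φ⁰_Λ(A) ≤ φ⁰_Δ(A) ≤ P(A) ≤ φ¹_Δ(A) ≤ φ¹_Λ(A)`: enlarging the region tightens both finite-volume bounds.
[cite: Grimmett2006, Thm. (4.19)(c) eq. (4.21) with eq. (4.24)] -/
theorem regionFreeReal_le_regionFreeReal_le_real (hP : FKGibbs d p q P) (hp : p ∈ Set.Icc (0 : ℝ) 1)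
    (hq : 1 ≤ q) {Λ Δ : Finset (Site d)} (hΛ : Λ ⊆ Δ) {A : Set (BondConfig (Site d))} (hA : IsUpperSet A)
    (hAΛ : DeterminedBy A ↑(edgesIn (zdGraph d) Λ)) :
    regionFreeReal d p q Λ A ≤ regionFreeReal d p q Δ A ∧ regionFreeReal d p q Δ A ≤ P.real A ∧
      P.real A ≤ regionWiredReal d p q Δ A ∧ regionWiredReal d p q Δ A ≤ regionWiredReal d p q Λ A :=
  ⟨regionFreeReal_mono hp hq hΛ hA,
    hP.regionFreeReal_le Δ hA (hAΛ.mono (Finset.coe_subset.2 (edgesIn_zdGraph_mono hΛ))),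
    hP.le_regionWiredReal Δ hA (hAΛ.mono (Finset.coe_subset.2 (edgesIn_zdGraph_mono hΛ))),
    regionWiredReal_anti hp hq hΛ hA hAΛ⟩

end FKGibbs

end Summit.CriticalPhenomena.PercolationContinuityZ3.Theorems.FK

end
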